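/-
Copyright (c) 2026 the pub-hodgecm-mathlib formalisation cell (harness21).  Prover seat hodgecm-mathlib-K2E3-p04 (g0), Track B ∕ K2-LIT
(build stream 29), h413 = `stmt-HodgeConjecture-24833`, line `K2_E3_EllipticInputs`, socket module «U4Keys», SIGS-TABLE row #4 — the payment of
`K2E3EllipticInputs.U4Keys.sig_K2E3PSRegularReducibleCompZero` TOKEN FOR TOKEN.  2026-09-03.
-/
import Summits.HodgeConjecture.HodgeConjecture.Theorems.F0P3ReducibleOfIntertwiningCompositionZero   -- ★ K5c (the ⇐ half) and its whole ★ apparatus: N1 `U3PrincipalSeriesJacquetFiltration_iff ∕ _holds`, ★ `F0P2pCmPrincipalSeriesInterface` (smoothness, Frobenius uniqueness form, no zero-Jacquet constituent from N6 ★ `_holds`), ★ `F0P2pEigenlineFunctionals`, ★ `JacquetRankStrictMono`, ★ `isLimitOfCompactOpen_cmBorelTriple_N`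
import Literature.NumberTheory.Automorphic.JacquetNonvanishingOfEmbedding                          -- ★ `apply_eq_of_eigenvector_of_finrank_eq_one_of_intertwiningMap_normalizedInd` (on a Jacquet LINE the Levi acts by the inducing character)
import HarnessLib

/-!
# h413 ∕ Track B «K2-LIT», line `K2_E3_EllipticInputs`, unit U4 «Keys», file U4-a: CASSELMAN'S CRITERION, ⇒ HALF — a REDUCIBLE regular principal
# series `i_G(χ)` of `U(Φ₃)(L⁺_v)` has ALL compositions `i_G(χ) → i_G(wχ) → i_G(χ)` of intertwining maps equal to zero
# (payment of `Cruxes/H413/Lines/K2_E3_EllipticInputsSigs_U4Keys.lean :: sig_K2E3PSRegularReducibleCompZero`, statement bytes frozen)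

Cell `pub/hodgecm-mathlib`, crux H413 = `stmt-HodgeConjecture-24833`, route of record `HCCMUnconditional`; chair K2-lead (g0), dealer K2E3-plan (g0),
EMIT «SKELETON LANDED K2E3» (REQUESTS l.72411) row #4 `sig_K2E3PSRegularReducibleCompZero` (L) ↦ seat K2E3-p04.
THEOREMS ONLY (no `def`, no `instance`, no `notation`, no named-fact hypothesis, no `sorry`); imports = two ★ modules + HarnessLib;
lane `--supports stmt-HodgeConjecture-24833 --as helper` (count-neutral: one brick of U4 «Keys»; with U4-b∕U4-c it feeds `keysReducibleList_of_sigs`).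

THE STATEMENT (bytes of the socket).  `G = U(Φ₃)(L⁺_v)` at a NON-SPLIT finite place `v` of `L⁺` (`L` CM), `χ = (χ₁, χ₂)` a continuous character pair
of the diagonal torus (★ `cmTorusCharPair`), REGULAR: `χ ≠ wχ = (χ̄₁⁻¹, χ₂)` (★ `cmTorusCharPair L v (conjInvChar σ χ₁) χ₂`).  If `i_G(χ)` (★
`cmPrincipalSeries L 3 v χ`, normalised induction) has a `G`-stable subspace `⊥ ≠ N ≠ ⊤`, then for ALL `G`-maps `A : i_G(χ) → i_G(wχ)`,
`B : i_G(wχ) → i_G(χ)` one has `B ∘ A = 0`.  This is the direction «reducible ⇒ `γ(χ) = 0`» of [Casselman1995, Thm. 6.6.2] («for regular `χ`,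
`i(χ)` is irreducible iff `T_{w⁻¹} T_w ≠ 0`»), [Keys1984, §7 p. 126]; the tree already holds «`γ(χ) = 0` ⇒ reducible» (★ K5c
`F0P3ReducibleOfIntertwiningCompositionZero.cmPrincipalSeries_reducible_of_forall_comp_eq_zero`).

THE PROOF (strategy: Jacquet-module EXPONENT bookkeeping à la [Casselman1995, Prop. 7.1.3] — no intertwining integral, no `c`-function; every
input ★).  Write `r = r_B` for the normalised Jacquet functor along the Borel `B = TN` (★ `Representation.normalizedJacquet`).
* (a) `End_G(i_G(χ)) = ℂ` for regular `χ`: by ★ N1 ([Casselman1995, L. 7.1.1 (a)]) `r i_G(χ)` is a plane with a `wχ`-LINE, so `Hom_T(r i_G(χ), ℂ_χ)` is a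
  line (★ `intertwiningMap_character_eq_smul`), hence so is `Hom_G(i_G(χ), i_G(χ))` by Frobenius (★ `intertwiningMap_cmPrincipalSeries_eq_smul`):
  `B ∘ A = c · id`.  [cite: Casselman1995, Thm. 3.2.4 p. 34; §7.1 L. 7.1.1 p. 67] [cite: BernsteinZelevinsky1977, Prop. 1.9 (b), Thm. 2.9]
* (b) `A` KILLS `N`: `r N` is a LINE (★ `finrank_coinvariants_eq_one_of_ne_bot_of_ne_top`: `0 < dim r N < dim r i_G(χ) = 2`
  by exactness + «no constituent of `i_G(χ)` has `r = 0`», ★ N6 through ★ `not_subsingleton_coinvariants_of_isConstituentOf_cmPrincipalSeries`); the inclusion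
  `N ↪ i_G(χ)` makes `T` act on that line by `χ` (Frobenius, ★ `…_of_intertwiningMap_normalizedInd`); were `A|_N ≠ 0`, the map `N → i_G(wχ)` would make `T`
  act by `wχ` as well, so `χ = wχ` — excluded.  [cite: Casselman1995, Prop. 7.1.3 p. 67; Cor. 6.3.7 p. 59] [cite: BernsteinZelevinsky1977, Prop. 1.9 (a)(b)]
* (c) evaluate `B ∘ A = c · id` at a non-zero vector of `N`: `c = 0`.
So the file is SHORT because the tree's K1w∕T3 pay-down (seats F0P2-p*, F0P3-*) already formalised Casselman §§3.2, 6.3, 7.1 for this group.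

* §1 `comp_eq_zero_of_ne_bot_ne_top` · the whole argument (a)–(c) over an ABSTRACT pair `I, I'` with the interface as hypotheses (generic group, small
  types: this is where all rewriting happens), in the style of ★ K5c §1 ∕ ★ `isConstituentOf_of_weylData`.
* §2 `normalizedJacquet_apply_eq_smul_of_finrank_eq_one_of_intertwiningMap_cmPrincipalSeries` · one interface item at `cmPrincipalSeries L 3 v χ` (Frobenius on a
  Jacquet line), the only place where `cmPrincipalSeries` meets its `normalizedInd` spelling.
* §3 **`PSRegularReducibleCompZero`** · `sig_K2E3PSRegularReducibleCompZero` TOKEN FOR TOKEN (binder `(v : Pl L)` spelled `HeightOneSpectrum (𝓞 L⁺)`, the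
  organ's reducible `abbrev`, as in ★ `K2E1OccursCountable`); ONE `exact` of §1.  Tie probe at home: `K2/K2E3-p04/g0/Probe_K2E3PSRegularReducibleCompZero.lean`
  (`example : type_of% @…U4Keys.sig_K2E3PSRegularReducibleCompZero := PSRegularReducibleCompZero`).

WHAT IS NOT HERE.  Keys' list itself (U4-b: WHICH regular `χ` are reducible — the zeros of `γ(χ)`, [Keys1984, §5, §7 (2)]), the irregular case (U4-c),
`dim Hom_G(i(χ), i(wχ)) ≤ 1` (U4-d) — although (a) is U4-e's content, U4-e is a separate socket and is not claimed here.

HONEST LABEL.  HC_CM is proved only modulo the 7 printed citations (2 remaining named inputs: hLiu418 = `stmt-HodgeConjecture-24832`, h413 =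
`stmt-HodgeConjecture-24833`) until rung 0 closes; this file moves no counter.

## References
* [Casselman1995] W. Casselman, *Introduction to the theory of admissible representations of `p`-adic reductive groups* (draft 1 May 1995):
  Thm. 3.2.4 (Frobenius) p. 34, Prop. 3.2.3 (exactness) p. 34, Cor. 6.3.7 p. 59, §6.4 Prop. 6.4.1 p. 62, Thm. 6.6.2 p. 66, §7.1 L. 7.1.1, Cor. 7.1.2, Prop. 7.1.3 p. 67.
* [BernsteinZelevinsky1977] I. N. Bernstein, A. V. Zelevinsky, *Induced representations of reductive `p`-adic groups I*, Ann. Sci. ÉNS 10 (1977),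
  Prop. 1.9 (a)(b), §2.3, Thm. 2.9.
* [Keys1984] D. Keys, *Principal series representations of special unitary groups over local fields*, Compositio Math. 51 (1984), §3 Thms. 1–3, §7 p. 126.
* [Rogawski1990] J. D. Rogawski, *Automorphic Representations of Unitary Groups in Three Variables*, Ann. of Math. Stud. 123 (1990), §12.1 p. 171, §12.2 p. 173.
-/

set_option autoImplicit false
-- the mandated namespace repeats the single-problem summit's segment (`HodgeConjecture.HodgeConjecture`)
set_option linter.dupNamespace false

noncomputable section

open NumberField IsDedekindDomain MeasureTheory
open scoped Matrix

open Literature.NumberTheory Literature.NumberTheory.Automorphic Literature.NumberTheory.Automorphic.UnitaryGroup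
open Literature.NumberTheory.Rogawski1990
open Literature.RepresentationTheory.FiniteGroups Literature.RepresentationTheory.Semisimple

namespace Summit.HodgeConjecture.HodgeConjecture.Cruxes.H413.K2E3PSRegularReducibleCompZero

open F0P2pCmPrincipalSeriesInterface F0P2pEigenlineFunctionals

universe u

/-! ## §1 The argument over an abstract pair `I ≅ i(χ)`, `I' ≅ i(χ')` (cheap elaboration; the CM head instantiates it syntactically) -/

section Abstract

variable {G : Type u} [Group G] [TopologicalSpace G] [IsTopologicalGroup G] (t : ParabolicTriple G) [LocallyCompactSpace t.P]

/-- **[Casselman1995, Thm. 6.6.2], direction «reducible ⇒ all compositions vanish», abstract form.**  `t = (P, M, N)` with `N` a limit of compact open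
subgroups, `χ ≠ χ'` characters of `M`; `I` (smooth), `I'` are any representations standing for `i(χ)`, `i(χ')` with the interface: Frobenius for `End_G(I)` in
uniqueness form (`Hom_M(r I, ℂ_χ)` a line ⇒ `End_G(I)` a line), the Jacquet filtration datum of `I` (`r I` a plane with a `χ'`-LINE), «every constituent of `I`
has `r ≠ 0`», and Frobenius on Jacquet LINES (a subrepresentation `N ≠ ⊥` of `I` with `dim r N = 1` has `M` acting on `r N` by `χ`; a non-zero `G`-map
`N → I'` from such an `N` makes `M` act by `χ'`).  Then every `G`-stable `⊥ ≠ N ≠ ⊤` of `I` forces `B ∘ A = 0` for all `A : I → I'`, `B : I' → I`: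
(a) `B ∘ A = c · id` (★ `intertwiningMap_character_eq_smul` + Frobenius); (b) `dim r N = 1` (★ `finrank_coinvariants_eq_one_of_ne_bot_of_ne_top`), so `A|_N ≠ 0`
would give `χ = χ'` on the line `r N` — hence `A|_N = 0`; (c) evaluate (a) on a non-zero vector of `N`: `c = 0`.
[cite: Casselman1995, Thm. 6.6.2 p. 66; Prop. 7.1.3 p. 67; §7.1 L. 7.1.1; Thm. 3.2.4 p. 34] [cite: BernsteinZelevinsky1977, Prop. 1.9 (a)(b), Thm. 2.9] -/
theorem comp_eq_zero_of_ne_bot_ne_top (hN : IsLimitOfCompactOpen t.N) (χ χ' : ↥t.M →* ℂˣ) (hne : χ ≠ χ')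
    {V V' : Type} [AddCommGroup V] [Module ℂ V] [AddCommGroup V'] [Module ℂ V']
    (I : Representation ℂ G V) (I' : Representation ℂ G V') (hsm : I.IsSmooth)
    (hEnd : (∀ ψ₁ ψ₂ : (I.normalizedJacquet t).IntertwiningMap ((Representation.trivial ℂ ↥t.M ℂ).twist χ), ψ₁ ≠ 0 → ∃ c : ℂ, ψ₂ = c • ψ₁) →
      ∀ B₁ B₂ : I.IntertwiningMap I, B₁ ≠ 0 → ∃ c : ℂ, B₂ = c • B₁)
    (hJ : FiniteDimensional ℂ (t.restrict I).Coinvariants ∧ Module.finrank ℂ (t.restrict I).Coinvariants = 2 ∧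
      ∃ ℓ : Submodule ℂ (t.restrict I).Coinvariants, Module.finrank ℂ ↥ℓ = 1 ∧
        (∀ (m : ↥t.M), ∀ x ∈ ℓ, I.normalizedJacquet t m x = ((χ' m : ℂˣ) : ℂ) • x))
    (hJH : ∀ c : IrrClass G, c.IsConstituentOf I → ∃ r : SmoothIrrep G, IrrClass.mk r = c ∧ Nontrivial (t.restrict r.ρ).Coinvariants)
    (hLine : ∀ N : Subrepresentation I, N ≠ ⊥ → Module.finrank ℂ (t.restrict N.toRepresentation).Coinvariants = 1 →
      ∀ (m : ↥t.M) (x : (t.restrict N.toRepresentation).Coinvariants),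
        N.toRepresentation.normalizedJacquet t m x = ((χ m : ℂˣ) : ℂ) • x)
    (hLine' : ∀ (N : Subrepresentation I) (f : N.toRepresentation.IntertwiningMap I'), f ≠ 0 →
      Module.finrank ℂ (t.restrict N.toRepresentation).Coinvariants = 1 →
      ∀ (m : ↥t.M) (x : (t.restrict N.toRepresentation).Coinvariants),
        N.toRepresentation.normalizedJacquet t m x = ((χ' m : ℂˣ) : ℂ) • x)
    (N : Subrepresentation I) (hb : N ≠ ⊥) (ht : N ≠ ⊤) (A : I.IntertwiningMap I') (B : I'.IntertwiningMap I) :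
    B.comp A = 0 := by
  obtain ⟨hfd, hX2, ℓ, hℓ1, hℓχ'⟩ := hJ
  haveI := hfd
  -- (b) `r N` is a line on which `M` acts by `χ`; a non-zero `A|_N` would make `M` act by `χ'` as well
  have h1 : Module.finrank ℂ (t.restrict N.toRepresentation).Coinvariants = 1 :=
    Representation.finrank_coinvariants_eq_one_of_ne_bot_of_ne_top t hN hsm hJH hX2 hb ht
  have hχN := hLine N hb h1
  have hAN : A.comp (Subrepresentation.subtypeIntertwiningMap N) = 0 := by
    by_contra hA
    haveI : Nontrivial (t.restrict N.toRepresentation).Coinvariants := Module.nontrivial_of_finrank_eq_succ h1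
    obtain ⟨x, hx⟩ := exists_ne (0 : (t.restrict N.toRepresentation).Coinvariants)
    have hχ'N := hLine' N _ hA h1
    exact hne (MonoidHom.ext fun m => Units.ext (smul_left_injective ℂ hx ((hχN m x).symm.trans (hχ'N m x))))
  -- (a) `End_G(I) = ℂ`: `B ∘ A = c • id`
  have huniq : ∀ ψ₁ ψ₂ : (I.normalizedJacquet t).IntertwiningMap ((Representation.trivial ℂ ↥t.M ℂ).twist χ), ψ₁ ≠ 0 →
      ∃ c : ℂ, ψ₂ = c • ψ₁ :=
    fun ψ₁ ψ₂ hψ₁ => intertwiningMap_character_eq_smul _ hX2 χ' χ hne.symm ℓ hℓ1 hℓχ' ψ₁ ψ₂ hψ₁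
  have hid : Representation.IntertwiningMap.id I ≠ 0 :=
    F0P2pWeylConstituentsRankOne.id_ne_zero_of_nontrivial_coinvariants t I (Module.nontrivial_of_finrank_pos (R := ℂ) (by omega))
  obtain ⟨c, hc⟩ := hEnd huniq (Representation.IntertwiningMap.id I) (B.comp A) hid
  -- (c) evaluate at a non-zero vector of `N`: `c = 0`
  obtain ⟨x, hx⟩ : ∃ x : ↥N.toSubmodule, Subrepresentation.subtypeIntertwiningMap N x ≠ 0 := by
    by_contra h0
    push Not at h0
    exact Subrepresentation.subtypeIntertwiningMap_ne_zero hb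
      (Representation.IntertwiningMap.ext (LinearMap.ext fun y => by simpa using h0 y))
  have hA0 : A (Subrepresentation.subtypeIntertwiningMap N x) = 0 := by
    have h := congrArg (fun T : N.toRepresentation.IntertwiningMap I' => T x) hAN
    simpa using h
  have hcx : c • Subrepresentation.subtypeIntertwiningMap N x = 0 := by
    have h := congrArg (fun T : I.IntertwiningMap I => T (Subrepresentation.subtypeIntertwiningMap N x)) hc
    simp only [Representation.IntertwiningMap.comp_apply, Representation.IntertwiningMap.smul_apply,
      Representation.IntertwiningMap.id_apply, hA0, map_zero] at h
    exact h.symm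
  have hc0 : c = 0 := (smul_eq_zero.1 hcx).resolve_right hx
  rw [hc, hc0, zero_smul]

end Abstract

/-! ## §2 One interface item at `cmPrincipalSeries L 3 v χ`: on a Jacquet LINE mapping non-trivially to `i_G(χ)`, `T` acts by `χ` -/

section CM

variable (L : Type) [Field L] [NumberField L] [IsCMField L] (v : HeightOneSpectrum (𝓞 ↥(maximalRealSubfield L)))

set_option synthInstance.maxHeartbeats 400000 in
set_option maxHeartbeats 8000000 in
-- statement-heavy: the `SmoothInd` carrier of `cmPrincipalSeries` met ONCE with its `normalizedInd` spelling (class of ★ `F0P2pCmPrincipalSeriesInterface`)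
/-- **Frobenius on a Jacquet line, read at `i_G(χ) = cmPrincipalSeries L 3 v χ`**: a smooth `π` whose Jacquet module `r_B π` along the Borel of `U(Φ₃)(L⁺_v)` is a
LINE and which maps NON-TRIVIALLY to `i_G(χ)` has `T` acting on `r_B π` by `χ` (★ `normalizedJacquet_apply_eq_smul_of_finrank_eq_one_of_intertwiningMap_normalizedInd`
at ★ `deltaChar_cmBorel_eq_one`; `cmPrincipalSeries L 3 v χ` IS `normalizedInd (cmBorelTriple L 3 v) ℂ_χ`). [cite: Casselman1995, Prop. 7.1.3 p. 67; Thm. 3.2.4 p. 34]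
[cite: BernsteinZelevinsky1977, Prop. 1.9 (b)] [cite: Rogawski1990, §12.1 p. 171] -/
theorem normalizedJacquet_apply_eq_smul_of_finrank_eq_one_of_intertwiningMap_cmPrincipalSeries
    (χ : ↥(torusU (conjLocal L (IsCMField.complexConj L) v) (cmLocalForm L 3 v)) →* ℂˣ)
    {W : Type*} [AddCommGroup W] [Module ℂ W]
    (π : Representation ℂ ↥(unitaryGroupOfForm (conjLocal L (IsCMField.complexConj L) v) (cmLocalForm L 3 v)) W) (hπ : π.IsSmooth)
    (h1 : Module.finrank ℂ ((cmBorelTriple L 3 v).restrict π).Coinvariants = 1)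
    (f : π.IntertwiningMap (cmPrincipalSeries L 3 v χ)) (hf : f ≠ 0) :
    haveI := locallyCompactSpace_cmBorelU L 3 v
    ∀ (m : ↥(cmBorelTriple L 3 v).M) (x : ((cmBorelTriple L 3 v).restrict π).Coinvariants),
      π.normalizedJacquet (cmBorelTriple L 3 v) m x = ((χ m : ℂˣ) : ℂ) • x :=
  haveI := locallyCompactSpace_cmBorelU L 3 v
  Representation.normalizedJacquet_apply_eq_smul_of_finrank_eq_one_of_intertwiningMap_normalizedInd (cmBorelTriple L 3 v) π
    (F0P2nBorelCharactersUnipotent.deltaChar_cmBorel_eq_one L v) hπ χ h1 f hf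

end CM

/-! ## §3 The socket `sig_K2E3PSRegularReducibleCompZero`, token for token -/

set_option synthInstance.maxHeartbeats 400000 in
set_option maxHeartbeats 8000000 in
-- statement-heavy: the socket's bytes (two `SmoothInd` carriers and their `IntertwiningMap` spaces) + ★ N1's datum; the proof is ONE `exact` of §1 (class of ★ K5c §2)
/-- **U4-a · `sig_K2E3PSRegularReducibleCompZero` — CASSELMAN'S CRITERION, ⇒ HALF.**  `G = U(Φ₃)(L⁺_v)`, `v` NON-SPLIT, `χ = (χ₁, χ₂)` continuous and REGULAR
(`χ ≠ wχ = (χ̄₁⁻¹, χ₂)`): if `i_G(χ)` has a `G`-stable `⊥ ≠ N ≠ ⊤` then EVERY composition `B ∘ A` of `G`-maps `A : i_G(χ) → i_G(wχ)`, `B : i_G(wχ) → i_G(χ)`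
is ZERO.  §1 at `I = i_G(χ)`, `I' = i_G(wχ)`, fed with: ★ N1 at `(χ₁, χ₂)` (the `wχ`-line of `r_B i_G(χ)`, line character respelled by ★ `cmWeylTorusCharPair_eq`),
Frobenius uniqueness ★ `intertwiningMap_cmPrincipalSeries_eq_smul`, «no constituent of `i_G(χ)` has zero Jacquet module» (★ N6 `_holds` through ★
`not_subsingleton_coinvariants_of_isConstituentOf_cmPrincipalSeries`), ★ `isLimitOfCompactOpen_cmBorelTriple_N`, and §2 twice (at `χ` for `N ↪ i_G(χ)`, at `wχ` for
`A|_N`).  «By Theorem 6.6.2 of [Casselman] … the principal series is reducible iff `γ(wλ, −s) γ(λ, s)` is zero» [Keys1984, §7 p. 126] — this is its ⇒ half;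
the ⇐ half is ★ K5c.  [cite: Casselman1995, Thm. 6.6.2 p. 66; §6.4 Prop. 6.4.1 p. 62; Prop. 7.1.3 p. 67; Thm. 3.2.4 p. 34]
[cite: Keys1984, §3 Thms. 1–3, §7 Theorem p. 126] [cite: BernsteinZelevinsky1977, Thm. 2.9, Prop. 1.9 (b)] [cite: Rogawski1990, §12.2 p. 173] -/
theorem PSRegularReducibleCompZero :
  ∀ (L : Type) [Field L] [NumberField L] [IsCMField L] (v : HeightOneSpectrum (𝓞 ↥(maximalRealSubfield L))),
    (∀ w : PlacesOver L v, IsCMField.complexConj L • w.1 = w.1) →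
    ∀ (χ₁ : (UnitaryGroup.LocalRing L v)ˣ →* ℂˣ) (χ₂ : ↥(normOneUnits (conjLocal L (IsCMField.complexConj L) v)) →* ℂˣ), Continuous (fun x => ((χ₁ x : ℂˣ) : ℂ)) → Continuous (fun x => ((χ₂ x : ℂˣ) : ℂ)) → UnitaryGroup.cmTorusCharPair L v χ₁ χ₂ ≠ UnitaryGroup.cmTorusCharPair L v (UnitaryGroup.conjInvChar (conjLocal L (IsCMField.complexConj L) v) χ₁) χ₂ →
      (∃ N : Subrepresentation (UnitaryGroup.cmPrincipalSeries L 3 v (UnitaryGroup.cmTorusCharPair L v χ₁ χ₂)), N ≠ ⊥ ∧ N ≠ ⊤) →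
      (∀ (A : (UnitaryGroup.cmPrincipalSeries L 3 v (UnitaryGroup.cmTorusCharPair L v χ₁ χ₂)).IntertwiningMap (UnitaryGroup.cmPrincipalSeries L 3 v (UnitaryGroup.cmTorusCharPair L v (UnitaryGroup.conjInvChar (conjLocal L (IsCMField.complexConj L) v) χ₁) χ₂))) (B : (UnitaryGroup.cmPrincipalSeries L 3 v (UnitaryGroup.cmTorusCharPair L v (UnitaryGroup.conjInvChar (conjLocal L (IsCMField.complexConj L) v) χ₁) χ₂)).IntertwiningMap (UnitaryGroup.cmPrincipalSeries L 3 v (UnitaryGroup.cmTorusCharPair L v χ₁ χ₂))), B.comp A = 0) := by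
  intro L _ _ _ v hns χ₁ χ₂ h₁ h₂ hreg hred A B
  haveI := locallyCompactSpace_cmBorelU L 3 v
  obtain ⟨N, hb, ht⟩ := hred
  -- ★ N1: `r_B i_G(χ)` is a plane with a `wχ`-line `ℓ`
  obtain ⟨hfd, hX2, ℓ, hℓ1, hline, -⟩ := (UnitaryGroup.U3PrincipalSeriesJacquetFiltration_iff L).1
    (F0P3U3PrincipalSeriesJacquetFiltrationHolds.U3PrincipalSeriesJacquetFiltration_holds L) v hns χ₁ χ₂ h₁ h₂
  have hsm : (cmPrincipalSeries L 3 v (cmTorusCharPair L v χ₁ χ₂)).IsSmooth := isSmooth_cmPrincipalSeries L v _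
  exact comp_eq_zero_of_ne_bot_ne_top (cmBorelTriple L 3 v) (isLimitOfCompactOpen_cmBorelTriple_N L 3 v)
    (cmTorusCharPair L v χ₁ χ₂) (cmTorusCharPair L v (conjInvChar (conjLocal L (IsCMField.complexConj L) v) χ₁) χ₂) hreg
    (cmPrincipalSeries L 3 v (cmTorusCharPair L v χ₁ χ₂))
    (cmPrincipalSeries L 3 v (cmTorusCharPair L v (conjInvChar (conjLocal L (IsCMField.complexConj L) v) χ₁) χ₂)) hsm
    (fun huniq B₁ B₂ hB₁ => intertwiningMap_cmPrincipalSeries_eq_smul L v _ _ hsm huniq B₁ B₂ hB₁)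
    ⟨hfd, hX2, ℓ, hℓ1, fun m x hx => (hline m x hx).trans (by rw [cmWeylTorusCharPair_eq])⟩
    (fun c hc => by
      obtain ⟨r, rfl⟩ := IrrClass.mk_surjective c
      exact ⟨r, rfl, not_subsingleton_iff_nontrivial.mp fun h0 =>
        not_subsingleton_coinvariants_of_isConstituentOf_cmPrincipalSeries L v u3_isSupercuspidal_iff_jacquet_eq_zero_holds hns _ r hc h0⟩)
    (fun N hb h1 => normalizedJacquet_apply_eq_smul_of_finrank_eq_one_of_intertwiningMap_cmPrincipalSeries L v _ _
      (hsm.toRepresentation N) h1 (Subrepresentation.subtypeIntertwiningMap N) (Subrepresentation.subtypeIntertwiningMap_ne_zero hb))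
    (fun N f hf h1 => normalizedJacquet_apply_eq_smul_of_finrank_eq_one_of_intertwiningMap_cmPrincipalSeries L v _ _
      (hsm.toRepresentation N) h1 f hf)
    N hb ht A B

end Summit.HodgeConjecture.HodgeConjecture.Cruxes.H413.K2E3PSRegularReducibleCompZero

end
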